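import Mathlib
import HarnessLib

/-!
# Crux `EulerZoomLiouville.PowerGaugeEulerLiouville` (stmt-NavierStokesRegularity-19832), stubs `stub_selfSimilarC2Needle` /
# `stub_selfSimilarWeakRest`: THE EULER-HOMOGENEITY KILL IN THE SENSE OF DISTRIBUTIONS

Helper file (theorems only; `--supports stmt-NavierStokesRegularity-19832`; def-free; pure analysis, Mathlib only).  Hand
leafhand-ns-eulerzoomliouville-10 g1, weak-class twin of `Beltrami.eq_zero_of_add_smul_fderiv_self` (`…SelfSimilarBeltrami`).

The classical kill says: a differentiable field with `Ω + γ DΩ[y] = 0` (positively homogeneous of degree `−1/γ < 0`) that is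
continuous at the origin vanishes.  In the WEAK self-similar class (`stub_selfSimilarWeakRest`: `V ∈ H¹_loc`, `Ω = curl V ∈ L²_loc`
only) continuity at the origin is not available, but a LOCAL MASS BOUND replaces it: a homogeneous function of degree `κ` has
`∫_{B_r}‖Ω‖ ∼ r^{3+κ}`, so any better bound near the origin forces `Ω = 0`.  This file proves the distributional statement:

* `WeakHomogeneity.integral_comp_exp_smul_eq` — if `Ω ∈ L¹_loc(ℝ³; F)` satisfies the EULER IDENTITY IN `𝒟'` with degree `κ`,
  `∫ (Dφ(y)[y]) • Ω(y) dy = −(3+κ) ∫ φ • Ω` for every test function `φ` (`y·∇Ω = κΩ` weakly), then for every test function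
  `∫ φ(e^{−t}y) • Ω(y) dy = e^{(3+κ)t} ∫ φ • Ω` for all `t` (differentiation under the integral sign, the identity applied to the dilated
  test function, and the linear ODE `G' = (3+κ)G`);
* `WeakHomogeneity.ae_eq_zero_of_mass_le` — if moreover `∫_{B̄(0,r)} ‖Ω‖ ≤ C r^β` for `0 < r ≤ 1` with `β > 3 + κ`, then `Ω = 0` a.e.
  (`t → −∞` in the scaling law: `‖∫φ•Ω‖ ≤ ‖φ‖_∞ C R^β e^{(β−3−κ)t} → 0`; then `ae_eq_zero_of_integral_contDiff_smul_eq_zero`).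
For the crux: the weak vorticity form of CIV (3.4) with vanishing weak commutator is the Euler identity with `κ = −1/γ = −(2+ρ)`, and
`Ω ∈ L²_loc` gives the mass bound with `β = 3/2 > 3 + κ = 1 − ρ` (Cauchy–Schwarz); so the weak analogue of «commuting ⇒ irrotational»
(`RaySource.curl_eq_zero_of_convect_comm`) needs only the weak profile vorticity equation as further input (not proved here).

WHAT THIS IS NOT: not a statement about Euler or Navier–Stokes by itself; not a proof of any stub. [folklore; Hörmander, *The Analysis of
Linear Partial Differential Operators I*, §3.2 (homogeneous distributions and Euler's identity)]
-/

noncomputable section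

-- flat `Theorems/<Route><Decl>…` files of one crux share the namespace of the crux (tree convention)
set_option linter.dupNamespace false

open MeasureTheory Set Filter Topology Metric Function
open scoped RealInnerProductSpace NNReal ENNReal ContDiff

namespace Summit.NavierStokesRegularity.NavierStokesRegularity.Theorems.PowerGaugeEulerLiouville

namespace WeakHomogeneity

variable {F : Type*} [NormedAddCommGroup F] [NormedSpace ℝ F]

/-- `D(φ(c •))(y)[y] = Dφ(c y)[c y]` for differentiable `φ`. [folklore] -/
theorem fderiv_comp_smul_apply_self {φ : EuclideanSpace ℝ (Fin 3) → ℝ} (hφ : Differentiable ℝ φ) (c : ℝ)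
    (y : EuclideanSpace ℝ (Fin 3)) :
    fderiv ℝ (fun z : EuclideanSpace ℝ (Fin 3) => φ (c • z)) y y = fderiv ℝ φ (c • y) (c • y) := by
  have h : HasFDerivAt (fun z : EuclideanSpace ℝ (Fin 3) => φ (c • z))
      ((fderiv ℝ φ (c • y)).comp (c • ContinuousLinearMap.id ℝ (EuclideanSpace ℝ (Fin 3)))) y :=
    (hφ (c • y)).hasFDerivAt.comp y ((hasFDerivAt_id y).const_smul c)
  rw [h.fderiv]
  simp

/-- The derivative of the dilation family: `d/ds [φ(e^{−s} y) • w] = −Dφ(e^{−s}y)[e^{−s}y] • w`. [folklore] -/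
theorem hasDerivAt_comp_exp_smul {φ : EuclideanSpace ℝ (Fin 3) → ℝ} (hφ : Differentiable ℝ φ)
    (y : EuclideanSpace ℝ (Fin 3)) (w : F) (s : ℝ) :
    HasDerivAt (fun s : ℝ => φ (Real.exp (-s) • y) • w)
      ((-(fderiv ℝ φ (Real.exp (-s) • y) (Real.exp (-s) • y))) • w) s := by
  have h0 : HasDerivAt (fun s : ℝ => Real.exp (-s)) (Real.exp (-s) * (-1)) s :=
    (Real.hasDerivAt_exp (-s)).comp s (hasDerivAt_neg s)
  have h1 : HasDerivAt (fun s : ℝ => Real.exp (-s) • y) ((Real.exp (-s) * (-1)) • y) s := h0.smul_const y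
  have h2 := (hφ (Real.exp (-s) • y)).hasFDerivAt.comp_hasDerivAt s h1
  have h3 : HasDerivAt (fun s : ℝ => φ (Real.exp (-s) • y))
      (fderiv ℝ φ (Real.exp (-s) • y) ((Real.exp (-s) * (-1)) • y)) s := h2
  have h4 := h3.smul_const w
  refine h4.congr_deriv ?_
  rw [mul_neg_one, neg_smul, map_neg]

/-- **Scaling law of a homogeneous distribution.**  Let `Ω ∈ L¹_loc(ℝ³; F)` satisfy the Euler identity in `𝒟'` with degree `κ`:
`∫ Dφ(y)[y] • Ω(y) = −(3+κ) ∫ φ • Ω` for all test functions `φ`.  Then for every test function `φ` and every `t`,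
`∫ φ(e^{−t} y) • Ω(y) dy = e^{(3+κ)t} • ∫ φ • Ω`. [folklore] -/
theorem integral_comp_exp_smul_eq {Ω : EuclideanSpace ℝ (Fin 3) → F} (hΩ : LocallyIntegrable Ω volume) {κ : ℝ}
    (hhom : ∀ φ : EuclideanSpace ℝ (Fin 3) → ℝ, ContDiff ℝ ∞ φ → HasCompactSupport φ →
      ∫ y, (fderiv ℝ φ y y) • Ω y = -((3 + κ) • ∫ y, φ y • Ω y))
    {φ : EuclideanSpace ℝ (Fin 3) → ℝ} (hφ : ContDiff ℝ ∞ φ) (hφs : HasCompactSupport φ) (t : ℝ) :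
    ∫ y, φ (Real.exp (-t) • y) • Ω y = Real.exp ((3 + κ) * t) • ∫ y, φ y • Ω y := by
  have hφd : Differentiable ℝ φ := hφ.differentiable (by simp)
  have hφc : Continuous φ := hφ.continuous
  -- the radial derivative `ψ(z) = Dφ(z)[z]`: continuous, compactly supported, bounded
  have hψc : Continuous fun z : EuclideanSpace ℝ (Fin 3) => fderiv ℝ φ z z :=
    (hφ.continuous_fderiv (by simp)).clm_apply continuous_id
  have hψs : HasCompactSupport fun z : EuclideanSpace ℝ (Fin 3) => fderiv ℝ φ z z := by
    refine (hφs.fderiv (𝕜 := ℝ)).mono fun z hz => ?_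
    rw [mem_support] at hz ⊢
    contrapose! hz
    simp [hz]
  obtain ⟨Cψ, hCψ⟩ := hψc.bounded_above_of_compact_support hψs
  obtain ⟨R, hR⟩ := hφs.isCompact.isBounded.subset_closedBall (0 : EuclideanSpace ℝ (Fin 3))
  have hψ0 : ∀ z : EuclideanSpace ℝ (Fin 3), R < ‖z‖ → fderiv ℝ φ z z = 0 := by
    intro z hz
    have hz' : z ∉ tsupport φ := fun h => by
      have := hR h
      rw [mem_closedBall, dist_zero_right] at this
      linarith
    have hz'' : z ∉ tsupport (fderiv ℝ φ) := fun h => hz' (tsupport_fderiv_subset ℝ h)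
    simp [image_eq_zero_of_notMem_tsupport hz'']
  -- the dilation family and its derivative `G' = (3+κ) G`
  set G : ℝ → F := fun s => ∫ y, φ (Real.exp (-s) • y) • Ω y with hG
  have hderiv : ∀ s₀ : ℝ, HasDerivAt G ((3 + κ) • G s₀) s₀ := by
    intro s₀
    set R' : ℝ := Real.exp (s₀ + 1) * max R 0 with hR'
    set bound : EuclideanSpace ℝ (Fin 3) → ℝ :=
      fun y => Cψ * (closedBall (0 : EuclideanSpace ℝ (Fin 3)) R').indicator (fun y => ‖Ω y‖) y with hbound
    have hF_meas : ∀ᶠ s in 𝓝 s₀,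
        AEStronglyMeasurable (fun y : EuclideanSpace ℝ (Fin 3) => φ (Real.exp (-s) • y) • Ω y) volume :=
      Filter.Eventually.of_forall fun s =>
        (hφc.comp (continuous_const_smul (Real.exp (-s)))).aestronglyMeasurable.smul hΩ.aestronglyMeasurable
    have hF_int : Integrable (fun y : EuclideanSpace ℝ (Fin 3) => φ (Real.exp (-s₀) • y) • Ω y) volume :=
      hΩ.integrable_smul_left_of_hasCompactSupport (hφc.comp (continuous_const_smul (Real.exp (-s₀))))
        (hφs.comp_smul (Real.exp_pos _).ne')
    have hF'_meas : AEStronglyMeasurable (fun y : EuclideanSpace ℝ (Fin 3) =>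
        (-(fderiv ℝ φ (Real.exp (-s₀) • y) (Real.exp (-s₀) • y))) • Ω y) volume :=
      ((hψc.comp (continuous_const_smul (Real.exp (-s₀)))).neg).aestronglyMeasurable.smul hΩ.aestronglyMeasurable
    have h_bound : ∀ᵐ y : EuclideanSpace ℝ (Fin 3) ∂volume, ∀ s ∈ ball s₀ (1 : ℝ),
        ‖(-(fderiv ℝ φ (Real.exp (-s) • y) (Real.exp (-s) • y))) • Ω y‖ ≤ bound y := by
      refine Filter.Eventually.of_forall fun y s hs => ?_
      rw [norm_smul, norm_neg, Real.norm_eq_abs]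
      by_cases hy : y ∈ closedBall (0 : EuclideanSpace ℝ (Fin 3)) R'
      · rw [hbound]
        simp only [indicator_of_mem hy]
        exact mul_le_mul_of_nonneg_right ((Real.norm_eq_abs _).symm.le.trans (hCψ _)) (norm_nonneg _)
      · -- outside the big ball the integrand vanishes
        have hs' : s < s₀ + 1 := by
          have := mem_ball.1 hs; rw [Real.dist_eq] at this; linarith [(abs_lt.1 this).2]
        have hy' : R' < ‖y‖ := by rw [mem_closedBall, dist_zero_right, not_le] at hy; exact hy
        have hz : R < ‖Real.exp (-s) • y‖ := by
          rw [norm_smul, Real.norm_eq_abs, abs_of_pos (Real.exp_pos _)]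
          have h1 : max R 0 < Real.exp (-s) * ‖y‖ := by
            have he : Real.exp (s₀ + 1) * max R 0 < ‖y‖ := hy'
            have he' : Real.exp (-s) * (Real.exp (s₀ + 1) * max R 0) < Real.exp (-s) * ‖y‖ :=
              mul_lt_mul_of_pos_left he (Real.exp_pos _)
            refine lt_of_le_of_lt ?_ he'
            rw [← mul_assoc, ← Real.exp_add]
            have : (1 : ℝ) ≤ Real.exp (-s + (s₀ + 1)) := Real.one_le_exp (by linarith)
            nlinarith [le_max_right R 0]
          exact lt_of_le_of_lt (le_max_left R 0) h1
        rw [hψ0 _ hz, abs_zero, zero_mul, hbound]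
        simp only [indicator_of_notMem hy, mul_zero, le_refl]
    have hbound_int : Integrable bound volume := by
      have h1 : IntegrableOn (fun y => ‖Ω y‖) (closedBall (0 : EuclideanSpace ℝ (Fin 3)) R') volume :=
        (hΩ.integrableOn_isCompact (isCompact_closedBall 0 R')).norm
      exact ((integrable_indicator_iff measurableSet_closedBall).2 h1).const_mul Cψ
    have h_diff : ∀ᵐ y : EuclideanSpace ℝ (Fin 3) ∂volume, ∀ s ∈ ball s₀ (1 : ℝ),
        HasDerivAt (fun s : ℝ => φ (Real.exp (-s) • y) • Ω y)
          ((-(fderiv ℝ φ (Real.exp (-s) • y) (Real.exp (-s) • y))) • Ω y) s :=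
      Filter.Eventually.of_forall fun y s _ => hasDerivAt_comp_exp_smul hφd y (Ω y) s
    have hmain := (hasDerivAt_integral_of_dominated_loc_of_deriv_le (ball_mem_nhds s₀ one_pos)
      hF_meas hF_int hF'_meas h_bound hbound_int h_diff).2
    -- the value of the derivative by the Euler identity for the dilated test function
    have hval : ∫ y, (-(fderiv ℝ φ (Real.exp (-s₀) • y) (Real.exp (-s₀) • y))) • Ω y = (3 + κ) • G s₀ := by
      have h1 := hhom (fun z => φ (Real.exp (-s₀) • z)) (hφ.comp (contDiff_id.const_smul _))
        (hφs.comp_smul (Real.exp_pos _).ne')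
      simp only [fderiv_comp_smul_apply_self hφd] at h1
      simp only [neg_smul, integral_neg, h1, neg_neg, hG]
    rw [hval] at hmain
    exact hmain
  -- integrate the linear ODE: `H s = e^{-(3+κ)s} • G s` is constant
  have hH : ∀ s : ℝ, HasDerivAt (fun s => Real.exp (-((3 + κ) * s)) • G s) 0 s := by
    intro s
    have he : HasDerivAt (fun s : ℝ => Real.exp (-((3 + κ) * s))) (Real.exp (-((3 + κ) * s)) * (-(3 + κ))) s := by
      have h1 : HasDerivAt (fun s : ℝ => -((3 + κ) * s)) (-(3 + κ)) s := by
        have := (hasDerivAt_id s).const_mul (-(3 + κ))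
        simp only [id, mul_one, neg_mul] at this
        exact this
      exact (Real.hasDerivAt_exp _).comp s h1
    have := he.smul (hderiv s)
    refine this.congr_deriv ?_
    rw [smul_smul]
    have : Real.exp (-((3 + κ) * s)) • (3 + κ) • G s + (Real.exp (-((3 + κ) * s)) * -(3 + κ)) • G s = 0 := by
      rw [smul_smul]; module
    simpa [smul_smul] using this
  have hconst : ∀ s : ℝ, Real.exp (-((3 + κ) * s)) • G s = Real.exp (-((3 + κ) * 0)) • G 0 := fun s =>
    is_const_of_deriv_eq_zero (fun s => (hH s).differentiableAt) (fun s => (hH s).deriv) s 0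
  have ht := hconst t
  simp only [mul_zero, neg_zero, Real.exp_zero, one_smul] at ht
  have hG0 : G 0 = ∫ y, φ y • Ω y := by simp [hG]
  -- `G t = e^{(3+κ)t} • G 0`
  have : G t = Real.exp ((3 + κ) * t) • G 0 := by
    rw [← ht, smul_smul, ← Real.exp_add]
    simp
  rw [← hG0]
  exact this

/-- **THE WEAK EULER-HOMOGENEITY KILL.**  Let `Ω ∈ L¹_loc(ℝ³; F)` satisfy the Euler identity in `𝒟'` with degree `κ`
(`∫ Dφ(y)[y] • Ω = −(3+κ)∫φ•Ω` for all test functions), and suppose the local mass bound `∫_{B̄(0,r)} ‖Ω‖ ≤ C r^β` for `0 < r ≤ 1`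
with `β > 3 + κ`.  Then `Ω = 0` almost everywhere. [folklore] -/
theorem ae_eq_zero_of_mass_le [CompleteSpace F] {Ω : EuclideanSpace ℝ (Fin 3) → F} (hΩ : LocallyIntegrable Ω volume) {κ : ℝ}
    (hhom : ∀ φ : EuclideanSpace ℝ (Fin 3) → ℝ, ContDiff ℝ ∞ φ → HasCompactSupport φ →
      ∫ y, (fderiv ℝ φ y y) • Ω y = -((3 + κ) • ∫ y, φ y • Ω y))
    {C β : ℝ} (hβ : 3 + κ < β)
    (hmass : ∀ r : ℝ, 0 < r → r ≤ 1 → ∫ y in closedBall (0 : EuclideanSpace ℝ (Fin 3)) r, ‖Ω y‖ ≤ C * r ^ β) :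
    Ω =ᵐ[volume] 0 := by
  refine ae_eq_zero_of_integral_contDiff_smul_eq_zero hΩ fun φ hφ hφs => ?_
  have hφc : Continuous φ := hφ.continuous
  obtain ⟨Cφ, hCφ⟩ := hφc.bounded_above_of_compact_support hφs
  have hCφ0 : 0 ≤ Cφ := le_trans (norm_nonneg _) (hCφ 0)
  obtain ⟨R₀, hR₀⟩ := hφs.isCompact.isBounded.subset_closedBall (0 : EuclideanSpace ℝ (Fin 3))
  set R : ℝ := max R₀ 1 with hRdef
  have hR1 : 1 ≤ R := le_max_right _ _
  have hR0 : 0 < R := lt_of_lt_of_le one_pos hR1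
  have hφ0 : ∀ z : EuclideanSpace ℝ (Fin 3), R < ‖z‖ → φ z = 0 := by
    intro z hz
    have hz' : z ∉ tsupport φ := fun h => by
      have := hR₀ h
      rw [mem_closedBall, dist_zero_right] at this
      linarith [le_max_left R₀ 1]
    exact image_eq_zero_of_notMem_tsupport hz'
  have hC0 : 0 ≤ C := by
    have h := hmass 1 one_pos le_rfl
    rw [Real.one_rpow, mul_one] at h
    exact le_trans (integral_nonneg fun _ => norm_nonneg _) h
  -- the bound `‖G t‖ ≤ Cφ C (e^t R)^β` for `e^t R ≤ 1`
  have hGt : ∀ t : ℝ, Real.exp t * R ≤ 1 →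
      ‖∫ y, φ (Real.exp (-t) • y) • Ω y‖ ≤ Cφ * (C * (Real.exp t * R) ^ β) := by
    intro t ht
    have hr0 : 0 < Real.exp t * R := mul_pos (Real.exp_pos t) hR0
    set g : EuclideanSpace ℝ (Fin 3) → ℝ :=
      fun y => Cφ * (closedBall (0 : EuclideanSpace ℝ (Fin 3)) (Real.exp t * R)).indicator (fun y => ‖Ω y‖) y with hg
    have hgi : Integrable g volume := by
      have h1 : IntegrableOn (fun y => ‖Ω y‖) (closedBall (0 : EuclideanSpace ℝ (Fin 3)) (Real.exp t * R)) volume :=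
        (hΩ.integrableOn_isCompact (isCompact_closedBall 0 _)).norm
      exact ((integrable_indicator_iff measurableSet_closedBall).2 h1).const_mul Cφ
    have hle : ∀ᵐ y : EuclideanSpace ℝ (Fin 3) ∂volume, ‖φ (Real.exp (-t) • y) • Ω y‖ ≤ g y := by
      refine Filter.Eventually.of_forall fun y => ?_
      rw [norm_smul]
      by_cases hy : y ∈ closedBall (0 : EuclideanSpace ℝ (Fin 3)) (Real.exp t * R)
      · rw [hg]; simp only [indicator_of_mem hy]
        exact mul_le_mul_of_nonneg_right (hCφ _) (norm_nonneg _)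
      · have hy' : Real.exp t * R < ‖y‖ := by rw [mem_closedBall, dist_zero_right, not_le] at hy; exact hy
        have hz : R < ‖Real.exp (-t) • y‖ := by
          rw [norm_smul, Real.norm_eq_abs, abs_of_pos (Real.exp_pos _)]
          have := mul_lt_mul_of_pos_left hy' (Real.exp_pos (-t))
          rwa [← mul_assoc, ← Real.exp_add, neg_add_cancel, Real.exp_zero, one_mul] at this
        rw [hφ0 _ hz, norm_zero, zero_mul, hg]
        simp only [indicator_of_notMem hy, mul_zero, le_refl]
    have h1 := norm_integral_le_of_norm_le hgi hle
    have h2 : ∫ y, g y = Cφ * ∫ y in closedBall (0 : EuclideanSpace ℝ (Fin 3)) (Real.exp t * R), ‖Ω y‖ := by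
      rw [hg, integral_const_mul, integral_indicator measurableSet_closedBall]
    rw [h2] at h1
    exact h1.trans (mul_le_mul_of_nonneg_left (hmass _ hr0 ht) hCφ0)
  -- the scaling law turns it into `‖∫ φ • Ω‖ ≤ Cφ C R^β e^{(β - (3+κ)) t}` for all `t ≤ -log R`
  have hscal := integral_comp_exp_smul_eq hΩ hhom hφ hφs
  have hkey : ∀ t : ℝ, t ≤ -Real.log R →
      ‖∫ y, φ y • Ω y‖ ≤ Cφ * C * R ^ β * Real.exp ((β - (3 + κ)) * t) := by
    intro t ht
    have htR : Real.exp t * R ≤ 1 := by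
      have h1 : Real.exp t ≤ Real.exp (-Real.log R) := Real.exp_le_exp.2 ht
      rw [Real.exp_neg, Real.exp_log hR0] at h1
      calc Real.exp t * R ≤ R⁻¹ * R := mul_le_mul_of_nonneg_right h1 hR0.le
        _ = 1 := inv_mul_cancel₀ hR0.ne'
    have h := hGt t htR
    rw [hscal t, norm_smul, Real.norm_eq_abs, abs_of_pos (Real.exp_pos _)] at h
    -- divide by `e^{(3+κ)t}`
    have hexp : 0 < Real.exp ((3 + κ) * t) := Real.exp_pos _
    rw [← le_div_iff₀' hexp] at h
    have e1 : Real.exp ((β - (3 + κ)) * t) = Real.exp (t * β) / Real.exp ((3 + κ) * t) := by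
      rw [← Real.exp_sub]; ring_nf
    have hrhs : Cφ * (C * (Real.exp t * R) ^ β) / Real.exp ((3 + κ) * t) =
        Cφ * C * R ^ β * Real.exp ((β - (3 + κ)) * t) := by
      rw [e1, Real.mul_rpow (Real.exp_pos t).le hR0.le, ← Real.exp_mul]
      ring
    calc ‖∫ y, φ y • Ω y‖ ≤ Cφ * (C * (Real.exp t * R) ^ β) / Real.exp ((3 + κ) * t) := h
      _ = Cφ * C * R ^ β * Real.exp ((β - (3 + κ)) * t) := hrhs
  -- let `t → -∞`
  have hlim : Tendsto (fun t : ℝ => Cφ * C * R ^ β * Real.exp ((β - (3 + κ)) * t)) atBot (𝓝 0) := by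
    have h1 : Tendsto (fun t : ℝ => (β - (3 + κ)) * t) atBot atBot :=
      Tendsto.const_mul_atBot (by linarith) tendsto_id
    have h2 := Real.tendsto_exp_atBot.comp h1
    simpa using h2.const_mul (Cφ * C * R ^ β)
  have hle : ‖∫ y, φ y • Ω y‖ ≤ 0 :=
    le_of_tendsto_of_tendsto tendsto_const_nhds hlim
      (Filter.eventually_atBot.2 ⟨-Real.log R, fun t ht => hkey t ht⟩)
  exact norm_le_zero_iff.1 hle

omit [NormedSpace ℝ F] in
/-- **Cauchy–Schwarz mass bound**: if `‖Ω‖²` is integrable on the closed unit ball, then for `0 < r ≤ 1`,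
`∫_{B̄(0,r)} ‖Ω‖ ≤ (vol B̄(0,1))^{1/2} (∫_{B̄(0,1)} ‖Ω‖²)^{1/2} · r^{3/2}`. [folklore] -/
theorem mass_le_of_sq_integrableOn {Ω : EuclideanSpace ℝ (Fin 3) → F} (hΩm : AEStronglyMeasurable Ω volume)
    (hΩ2 : IntegrableOn (fun y => ‖Ω y‖ ^ 2) (closedBall (0 : EuclideanSpace ℝ (Fin 3)) 1) volume)
    {r : ℝ} (hr : 0 < r) (hr1 : r ≤ 1) :
    ∫ y in closedBall (0 : EuclideanSpace ℝ (Fin 3)) r, ‖Ω y‖ ≤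
      ((volume.real (closedBall (0 : EuclideanSpace ℝ (Fin 3)) 1)) ^ (1 / 2 : ℝ) *
        (∫ y in closedBall (0 : EuclideanSpace ℝ (Fin 3)) 1, ‖Ω y‖ ^ 2) ^ (1 / 2 : ℝ)) * r ^ (3 / 2 : ℝ) := by
  set B : Set (EuclideanSpace ℝ (Fin 3)) := closedBall 0 r with hB
  set μ : Measure (EuclideanSpace ℝ (Fin 3)) := volume.restrict B with hμ
  haveI : IsFiniteMeasure μ := isFiniteMeasure_restrict.2 measure_closedBall_lt_top.ne
  have hsub : B ⊆ closedBall (0 : EuclideanSpace ℝ (Fin 3)) 1 := closedBall_subset_closedBall hr1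
  have hΩ2r : IntegrableOn (fun y => ‖Ω y‖ ^ 2) B volume := hΩ2.mono_set hsub
  -- Hölder with exponents (2, 2) for `1 · ‖Ω‖` on `μ`
  have h1 : MemLp (fun _ : EuclideanSpace ℝ (Fin 3) => (1 : ℝ)) (ENNReal.ofReal 2) μ := memLp_const 1
  have h2 : MemLp (fun y => ‖Ω y‖) (ENNReal.ofReal 2) μ := by
    rw [show ENNReal.ofReal 2 = 2 by norm_num]
    exact (memLp_two_iff_integrable_sq hΩm.norm.restrict).2 hΩ2r
  have hH := integral_mul_le_Lp_mul_Lq_of_nonneg (μ := μ) Real.HolderConjugate.two_two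
    (Filter.Eventually.of_forall fun _ => zero_le_one) (Filter.Eventually.of_forall fun _ => norm_nonneg _) h1 h2
  simp only [one_mul, integral_const, smul_eq_mul] at hH
  rw [hμ, measureReal_restrict_apply_univ] at hH
  -- `vol B = r³ vol B̄(0,1)`
  have hvol : volume.real B = r ^ 3 * volume.real (closedBall (0 : EuclideanSpace ℝ (Fin 3)) 1) := by
    rw [measureReal_def, measureReal_def, hB, Measure.addHaar_closedBall' volume _ hr.le,
      ENNReal.toReal_mul, ENNReal.toReal_ofReal (by positivity), finrank_euclideanSpace_fin]
  -- monotonicity in the domain for the square integral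
  have hmono : ∫ y in B, ‖Ω y‖ ^ 2 ∂volume ≤ ∫ y in closedBall (0 : EuclideanSpace ℝ (Fin 3)) 1, ‖Ω y‖ ^ 2 ∂volume :=
    setIntegral_mono_set hΩ2 (Filter.Eventually.of_forall fun _ => sq_nonneg _) (Filter.Eventually.of_forall hsub)
  have hV0 : 0 ≤ volume.real (closedBall (0 : EuclideanSpace ℝ (Fin 3)) 1) := measureReal_nonneg
  have hI0 : 0 ≤ ∫ y in B, ‖Ω y‖ ^ 2 ∂volume := integral_nonneg fun _ => sq_nonneg _
  calc ∫ y in B, ‖Ω y‖ ∂volume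
      ≤ (volume.real B) ^ (1 / 2 : ℝ) * (∫ y in B, ‖Ω y‖ ^ 2 ∂volume) ^ (1 / 2 : ℝ) := by
        simpa [one_div] using hH
    _ ≤ (r ^ 3 * volume.real (closedBall (0 : EuclideanSpace ℝ (Fin 3)) 1)) ^ (1 / 2 : ℝ) *
          (∫ y in closedBall (0 : EuclideanSpace ℝ (Fin 3)) 1, ‖Ω y‖ ^ 2 ∂volume) ^ (1 / 2 : ℝ) := by
        rw [hvol]
        gcongr
    _ = ((volume.real (closedBall (0 : EuclideanSpace ℝ (Fin 3)) 1)) ^ (1 / 2 : ℝ) *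
          (∫ y in closedBall (0 : EuclideanSpace ℝ (Fin 3)) 1, ‖Ω y‖ ^ 2) ^ (1 / 2 : ℝ)) * r ^ (3 / 2 : ℝ) := by
        rw [Real.mul_rpow (by positivity) hV0, ← Real.rpow_natCast, ← Real.rpow_mul hr.le]
        norm_num
        ring

/-- **THE `L²_loc` FORM** (the case of the weak self-similar vorticity): an `L¹_loc` field on `ℝ³` which is a homogeneous distribution
of degree `κ < −3/2` (Euler identity in `𝒟'`) and is square-integrable on the unit ball vanishes a.e.  For `Ω = curl V`, `V ∈ H¹_loc`,
`κ = −(2+ρ)`, `ρ > 0`: every such weak-class vorticity is zero. [folklore] -/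
theorem ae_eq_zero_of_sq_integrableOn [CompleteSpace F] {Ω : EuclideanSpace ℝ (Fin 3) → F} (hΩ : LocallyIntegrable Ω volume)
    {κ : ℝ} (hκ : κ < -(3 / 2))
    (hhom : ∀ φ : EuclideanSpace ℝ (Fin 3) → ℝ, ContDiff ℝ ∞ φ → HasCompactSupport φ →
      ∫ y, (fderiv ℝ φ y y) • Ω y = -((3 + κ) • ∫ y, φ y • Ω y))
    (hΩ2 : IntegrableOn (fun y => ‖Ω y‖ ^ 2) (closedBall (0 : EuclideanSpace ℝ (Fin 3)) 1) volume) :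
    Ω =ᵐ[volume] 0 :=
  ae_eq_zero_of_mass_le hΩ hhom (β := 3 / 2) (by linarith)
    fun r hr hr1 => mass_le_of_sq_integrableOn hΩ.aestronglyMeasurable hΩ2 hr hr1

end WeakHomogeneity

end Summit.NavierStokesRegularity.NavierStokesRegularity.Theorems.PowerGaugeEulerLiouville

end
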